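/-
Copyright (c) 2026 The H21 formalisation project. All rights reserved.
Released under Apache 2.0 license as described in the file LICENSE.
-/
import Literature.NumberTheory.Rogawski1990.UnitOrbitalIntegralInertCountJZeroLargeTrace    -- LH4-p01 (g6) L1: `borel_coords_of_mem_flickerPH'`, `add_map_eq_neg_norm_of_rel`, (R-kill) `…_eq_zero_of_v_lt_of_rel`, (odd) `…_eq_zero_of_odd_of_rel` (+ (C3c), FILE 1∕2, Box ★)
import Literature.NumberTheory.Automorphic.UnitaryThreeBorelCosetCountJZeroNearXTrace          -- LH7-p02 (g6): the near count in the `X`-shape, every `ℓ ≥ 0` (`natCard_cosets_of_iff_norm_sub_le_xshape`)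
import Literature.NumberTheory.Rogawski1990.UnitOrbitalIntegralInertCountJZero               -- ★ F0P3b-p01: `cast_count_b_pack`, `cast_count_c_pack`, `le_div_two_iff`, `iThirteen`, `cast_index_eq` (CITE)
import HarnessLib

/-!
# Flicker's PROPOSITION 13 AS A COSET COUNT, regime `m ≤ N`, in the TRACE FRAME (every residue characteristic):
# `#{y ∈ P_H ⧸ (P_H ∩ H^K_m) : y⁻¹ τ y ∈ H^K_m} = iThirteen q N N₊ M m` over `u_m^{(y,z)}` and `UnramifiedLocalConjDatum`

Topic `NumberTheory/Rogawski1990` (road «D-N7-inert»); namespace `Literature.NumberTheory.Automorphic.UnitaryGroup`.  THEOREMS ONLY (no definition, no named fact, no instance,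
no notation, no `sorry`); kernel lane `--supports stmt-HodgeConjecture-24833`.  Cell `pub/hodgecm-mathlib`, crux H413; LAYER C block (C5)′ «CountJZero» of the (D-UNR) `j = 0` column
(dealer LH4-plan (g7) WORD #42∕#47∕#48; design census `F0/P3c/LH4/LH4-p03/g8/jzero/CENSUS-CountJZeroTrace.v1.md` 7f90bff231a5137b).  TWIN of ★ `Rogawski1990/UnitOrbitalIntegralInertCountJZero`
(`natCard_cosets_eq_iThirteen`: the symmetric corner `!![A,0,B;0,b,0;B,0,A]`, level element `u_m` with `yσy = −2`, ratio `(A − b)∕B = f + g`, datum `LocalConjDatum` with `|2| = 1`) for the GENERAL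
`j = 0` corner `!![A,0,B₁;0,b,0;B₂,0,D]` bound by the TRACE LETTERS `κ, b₀, G, r, s` of ★ (C3b) FILE 1 `UnitaryThreeBorelConjugateCongruencesJZeroTrace` (`B₁ = κσκ·B₂`, `A − D = (σκ − κ)B₂`,
`B₂G = (D − b − κB₂)s`, `r(κ + σκ) = b₀G + σb₀σG`, `b₀ + σb₀ = 1`; at the trace torus literal `κ = π∕σb`, `b₀ = b` — ★ `UnitaryThreeTraceTorusCornerLetters`), the level element ★ LAYER B 1∕3
`u_m^{(y,z)}` (`|y| = 1`, `|z| ≤ 1`, `z + σz + yσy = 0`, fibre constant `s = −yσy`), the datum `UnramifiedLocalConjDatum σ ϖ` and the characteristic token `(h2 : (2 : K) ≠ 0)`.  It is the `m ≤ N`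
companion of LH4-p01 (g6)'s `…CountJZeroLargeDispatchTrace` (`N < m`): SAME letters, same binder order, same regime datum `hreg`, `iThirteen q N Np M m` VERBATIM — so that the literal-level
assembler (LH5-p04 (g5) `…CountJZeroTorusAllTrace`) docks both halves with one `obtain` block.

THE MATHEMATICS [Flicker1998UnitaryFL, Prop. 13 (a)(b)(c) pp. 91–93; Prop. 8 p. 84].  With `|B₂| = |ϖ^N|`, type A `N₊ < N` (`|D − b| = |ϖ^{N₊}|`) or type B `N ≤ N₊`, `N ≤ M`, `|r(s+r)| = |ϖ^{M−N}|`,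
`|G − σG| = |ϖ^M|`, and `m ≤ N`: `m = 0` one coset; `2m ≤ min(N, N₊)` every coset (★ (C3c) `natCard_cosets_eq_index_of_le_of_rel`), value `[P_H : P_H ∩ H^K_m] = (q²−1)q^{4m−2}`; type A with
`N₊ < 2m` none (L1 `natCard_cosets_jzero_eq_zero_of_v_lt_of_rel`); type B `N < 2m ≤ M` (case (b)) the BOX `|ν⁻¹ + w₀| ≤ |ϖ^{m−[N∕2]}| ∧ |x + y₀| ≤ |ϖ^{m−[N∕2]}|` counted by ★ `natCard_cosets_of_iff_box_of_unram`,
value `(1+q⁻¹)q^{2m+2[N∕2]}` (`natCard_cosets_jzero_bd_of_le_of_rel`); type B `M < 2m` (case (c); here `2m ≤ 2N ≤ M + N` automatically): for `M − N` odd none (L1 `…_eq_zero_of_odd_of_rel`), for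
`M − N = 2ℓ` (`ℓ ≥ 0`) the norm-residue count `(1+q⁻¹)²q^{2m+N}` through the pointwise criterion `p⁻¹τp ∈ H^K_m ↔ |N(X) − r(s+r)| ≤ |ϖ^{2m−N}|`, `X = κ(uσu)⁻¹ + (x + z) + r`
(`conj_mem_flickerHK_iff_norm_sub_le_of_le_of_rel`) and LH7-p02's `X`-shape count `natCard_cosets_of_iff_norm_sub_le_xshape` BY NAME (centre `ξ₀ := z + r`, every `ℓ ≥ 0`, every residue
characteristic — (R0)).
In the `m ≤ N` half the congruences (2′)(3′) hold OUTRIGHT in type B (`|A − b|, |D − b| ≤ |B₂| ≤ |t|`, ★ (C3a) `conditions_two_three_iff_of_v_B₂_le`; `|D − b| ≤ |B₂|` is `v_sub_le_v_B₂_of_letters`),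
which is why the two in-file cells exist next to L1's `N ≤ m` ones.  `r` is read only in type-B cells: the binder is `(hrv : N ≤ Np → |r| ≤ 1)` — at the literal `|r| = |ϖ^{N₊−N}| > 1` in type A
(census (F-r)).  Prop. 8's numbers enter as the binders `hidx0 hidx hSN [Finite] hfib` (★'s text), discharged by ★ C2-C `UnitaryThreePHTowerPackageTrace` in the sequel.
HONEST LABEL: HC_CM is proved only modulo the 7 printed citations (2 remaining named inputs: hLiu418 = `stmt-HodgeConjecture-24832`, h413 = `stmt-HodgeConjecture-24833`) until rung 0 closes;
this file is count-neutral group bookkeeping, pays no organ and opens no road ((D-UNR) PRINT by D74′); it asserts no cell value of its own (the near value is NearX's).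

## References
* [Flicker1998UnitaryFL] Y. Z. Flicker, *Elementary proof of the fundamental lemma for a unitary group*, Canad. J. Math. 50 (1998), 74–98: Prop. 13 pp. 91–93, Prop. 8 p. 84, Prop. 10 p. 86.
* [Rogawski1990] J. D. Rogawski, *Automorphic Representations of Unitary Groups in Three Variables* (1990), §4.9 p. 55.
-/

set_option autoImplicit false

open scoped MatrixGroups WithZero Valued
open Matrix

namespace Literature.NumberTheory.Automorphic

namespace UnitaryGroup

open Literature.NumberTheory.Automorphic.HermitianLattice (unitaryInt mem_unitaryInt_iff UnramifiedLocalConjDatum)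
open Literature.NumberTheory.Rogawski1990.Flicker1998 (iThirteen)
open IsLocalRing

variable {K : Type*} [Field K] [Valued K ℤᵐ⁰] {ϖ : K} (σ : K →+* K) {J : Matrix (Fin 3) (Fin 3) K}

/-! ## §1 The type-B size of the eigen-differences and the pointwise criterion for `m ≤ N` -/

/-- **Type-B reading of the letters**: from `A − D = (σκ − κ)B₂`, `B₂G = (D − b − κB₂)s`, `r(κ + σκ) = b₀G + σb₀σG`, `b₀ + σb₀ = 1` with `|s| = 1`, `|κ|, |r|, |b₀| ≤ 1` and
`|G − σG| ≤ 1` one has `G = r(κ + σκ) + σb₀(G − σG)`, hence `|G| ≤ 1` and **`|D − b| ≤ |B₂|`, `|A − b| ≤ |B₂|`** (Flicker: `N ≤ N₊` — the eigen-differences are divisible by `B`).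
[cite: Flicker1998UnitaryFL, Prop. 13 p. 91] -/
theorem v_sub_le_v_B₂_of_letters (hvσ : ∀ a, Valued.v (σ a) = Valued.v a) {A B₂ D b κ b₀ G r s : K}
    (hsv : Valued.v s = 1) (hκ : Valued.v κ ≤ 1) (hrv : Valued.v r ≤ 1) (hb₀ : b₀ + σ b₀ = 1) (hb₀v : Valued.v b₀ ≤ 1)
    (hAD : A - D = (σ κ - κ) * B₂) (hG : B₂ * G = (D - b - κ * B₂) * s) (hr : r * (κ + σ κ) = b₀ * G + σ b₀ * σ G)
    (hΔ : Valued.v (G - σ G) ≤ 1) :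
    Valued.v (D - b) ≤ Valued.v B₂ ∧ Valued.v (A - b) ≤ Valued.v B₂ := by
  have hGe : G = r * (κ + σ κ) + σ b₀ * (G - σ G) := by linear_combination -hr - G * hb₀
  have hκκ : Valued.v (κ + σ κ) ≤ 1 := le_trans (Valuation.map_add _ _ _) (max_le hκ (by rw [hvσ]; exact hκ))
  have hGv : Valued.v G ≤ 1 := by
    rw [hGe]
    refine le_trans (Valuation.map_add _ _ _) (max_le ?_ ?_)
    · rw [map_mul]; exact mul_le_one' hrv hκκ
    · rw [map_mul, hvσ]; exact mul_le_one' hb₀v hΔ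
  have hDs : (D - b) * s = B₂ * (G + κ * s) := by linear_combination -hG
  have hD : Valued.v (D - b) ≤ Valued.v B₂ := by
    have h := congrArg Valued.v hDs
    rw [map_mul, hsv, mul_one, map_mul] at h
    rw [h]
    refine le_trans (mul_le_mul' le_rfl (le_trans (Valuation.map_add _ _ _) (max_le hGv ?_))) (by rw [mul_one])
    rw [map_mul, hsv, mul_one]; exact hκ
  refine ⟨hD, ?_⟩
  rw [show A - b = (A - D) + (D - b) by ring]
  refine le_trans (Valuation.map_add _ _ _) (max_le ?_ hD)
  rw [hAD, map_mul]
  exact le_trans (mul_le_mul' (le_trans (Valuation.map_sub _ _ _) (max_le (by rw [hvσ]; exact hκ) hκ)) le_rfl) (by rw [one_mul])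

/-- **The pointwise CASE-(c) CRITERION in the `X`-shape, regime `m ≤ N`** (twin of L1 `conj_mem_flickerHK_iff_norm_sub_le_of_rel`, which carries `N ≤ m`): with `|B₂| = |ϖ^N|`,
`m ≤ N ≤ 2m`, `|G − σG| ≤ |ϖ^{2m−N}|` and the type-B letters (`|κ|, |r|, |b₀| ≤ 1`), for every `p = p(u,x,w) ∈ P_H`:
`p⁻¹ τ p ∈ H^K_m ↔ |XσX − r(s+r)| ≤ |ϖ^{2m−N}|`, `X = κ(uσu)⁻¹ + (x + z) + r` — (4′) by ★ FILE 1 `corner_four_iff_norm_sub_le_trace`; (2′)(3′) hold OUTRIGHT because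
`|A − b|, |D − b| ≤ |B₂| ≤ |t|` (`v_sub_le_v_B₂_of_letters`, ★ (C3a) `conditions_two_three_iff_of_v_B₂_le`). [cite: Flicker1998UnitaryFL, Prop. 13 (c) pp. 92–93; Prop. 10 p. 86] -/
theorem conj_mem_flickerHK_iff_norm_sub_le_of_le_of_rel (hJ : J = (StdForm.antidiagonal 3).over K) (hd : UnramifiedLocalConjDatum σ ϖ) (h2 : (2 : K) ≠ 0)
    {y z : K} (hy : Valued.v y = 1) (hzv : Valued.v z ≤ 1) (hz : z + σ z + y * σ y = 0) {m N : ℕ} (hmN : m ≤ N) (hN : N ≤ 2 * m)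
    {c um τ : ↥(unitaryGroupOfForm σ J)} (hc : ((c : GL (Fin 3) K) : Matrix (Fin 3) (Fin 3) K) = !![1, 0, 0; 0, -1, 0; 0, 0, 1])
    (hum : ((um : GL (Fin 3) K) : Matrix (Fin 3) (Fin 3) K) = !![ϖ ^ m, y, z * (ϖ ^ m)⁻¹; 0, 1, -σ y * (ϖ ^ m)⁻¹; 0, 0, (ϖ ^ m)⁻¹])
    {A B₁ B₂ D b κ b₀ G r s : K} (hs : s = -(y * σ y)) (hκ : Valued.v κ ≤ 1) (htr : κ + σ κ ≠ 0) (hrv : Valued.v r ≤ 1)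
    (hb₀ : b₀ + σ b₀ = 1) (hb₀v : Valued.v b₀ ≤ 1)
    (hB₁ : B₁ = κ * σ κ * B₂) (hAD : A - D = (σ κ - κ) * B₂) (hG : B₂ * G = (D - b - κ * B₂) * s) (hr : r * (κ + σ κ) = b₀ * G + σ b₀ * σ G)
    (hB : Valued.v B₂ = Valued.v (ϖ ^ N)) (hΔ : Valued.v (G - σ G) ≤ Valued.v (ϖ ^ (2 * m - N)))
    (hτ : ((τ : GL (Fin 3) K) : Matrix (Fin 3) (Fin 3) K) = !![A, 0, B₁; 0, b, 0; B₂, 0, D])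
    (hτH : τ ∈ Subgroup.centralizer ({c} : Set ↥(unitaryGroupOfForm σ J)))
    {p : ↥(unitaryGroupOfForm σ J)} (hp : p ∈ flickerPH σ J c) {u x w : K}
    (hpm : ((p : GL (Fin 3) K) : Matrix (Fin 3) (Fin 3) K) = !![u, 0, u * x; 0, w, 0; 0, 0, (σ u)⁻¹]) :
    p⁻¹ * τ * p ∈ flickerHK σ J c um ↔
      Valued.v ((κ * (u * σ u)⁻¹ + (x + z) + r) * σ (κ * (u * σ u)⁻¹ + (x + z) + r) - r * (s + r)) ≤ Valued.v (ϖ ^ (2 * m - N)) := by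
  have vle : ∀ {a b : ℕ}, Valued.v (ϖ ^ a) ≤ Valued.v (ϖ ^ b) ↔ b ≤ a := fun {a b} => by
    rw [hd.v_pow, hd.v_pow, WithZero.exp_le_exp]; omega
  obtain ⟨hvu, hvx, hσx, hvw, -⟩ := borel_coords_of_mem_flickerPH' σ hJ hd.σσ hd.vσ h2 hc hp hpm
  have hu0 : u ≠ 0 := fun h => by rw [h, map_zero] at hvu; exact zero_ne_one hvu
  have hσu0 : σ u ≠ 0 := fun h => hu0 (by rw [← hd.σσ u, h, map_zero])
  have hw0 : w ≠ 0 := fun h => by rw [h, map_zero] at hvw; exact zero_ne_one hvw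
  have hpH : p ∈ Subgroup.centralizer ({c} : Set ↥(unitaryGroupOfForm σ J)) := ((mem_flickerPH_iff h2 hc).1 hp).1.1
  have hn : Valued.v (u * σ u) = 1 := by rw [map_mul, hd.vσ, hvu, mul_one]
  have hσn : σ (u * σ u) = u * σ u := by rw [map_mul, hd.σσ, mul_comm]
  obtain ⟨hws, hvs'⟩ := add_map_eq_neg_norm_of_rel σ hd.vσ hy hz hσx
  have hvs : Valued.v s = 1 := by rw [hs]; exact hvs'
  rw [← hs] at hws
  obtain ⟨hwv, hσwv, -, -, -⟩ := trace_fibre_coord σ hd hy hzv hz hvx hσx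
  obtain ⟨hDB, hAB⟩ := v_sub_le_v_B₂_of_letters σ hd.vσ hvs hκ hrv hb₀ hb₀v hAD hG hr (le_trans hΔ (hd.v_pow_le_one _))
  have hB₂m : Valued.v B₂ ≤ Valued.v (ϖ ^ m) := by rw [hB, vle]; exact hmN
  rw [borel_conj_mem_flickerHK_iff_of_rel_normForm σ hJ hd hy hz m hu0 hσu0 hw0 hσx hum hpm hτ hpH hτH rfl,
    and_iff_right (show Valued.v ((u * σ u) * B₂) ≤ 1 by rw [map_mul, hn, one_mul, hB]; exact hd.v_pow_le_one N)]
  have hiff := corner_four_iff_norm_sub_le_trace σ hd (b := b) hB hN hn hσn hws htr hb₀ hb₀v hB₁ hAD hG hr hΔ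
  have h23 := (conditions_two_three_iff_of_v_B₂_le σ (A := A) (D := D) (b := b) hB₂m hn hwv hσwv).2
    ⟨le_trans hAB hB₂m, le_trans hDB hB₂m⟩
  constructor
  · rintro ⟨-, -, h₄⟩; exact hiff.1 h₄
  · intro hsol; exact ⟨h23.1, h23.2, hiff.2 hsol⟩

/-! ## §2 The coset counts, regime `m ≤ N` -/

section Count

variable [IsDiscreteValuationRing 𝒪[K]] [Finite (ResidueField 𝒪[K])] [IsAdicComplete (maximalIdeal 𝒪[K]) 𝒪[K]]

/-- **(R-bd) as a coset count, trace frame, regime `m ≤ N`** (case (b): `1 ≤ m ≤ N < 2m`, `|C|, |Δ| ≤ |ϖ^{2m−N}|`, `C = r(s+r)`, `Δ = G − σG`): the conjugation condition is the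
BOX `|ν⁻¹ + w₀| ≤ |ϖ^k| ∧ |x + y₀| ≤ |ϖ^k|`, `k = m − [N∕2]`, where `z + r = κw₀ + y₀` (★ FILE 1 `corner_four_iff_box_of_bounded_trace` for (4′); (2′)(3′) outright from
`|A − b|, |D − b| ≤ |B₂| ≤ |t|`; `|w₀| = 1` by ★ FILE 2 `v_eq_one_of_trace_mul_eq`), so the count is `F · (q^{m−k}·q^{m−1}(q+1)) · q^{m−k}` by ★ `natCard_cosets_of_iff_box_of_unram` —
twin of L1 `natCard_cosets_jzero_bd_of_rel` (`N ≤ m`) and of ★ CountJZero's case (b), RHS verbatim, every residue characteristic. [cite: Flicker1998UnitaryFL, Prop. 13 (b) pp. 91–93] -/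
theorem natCard_cosets_jzero_bd_of_le_of_rel (hJ : J = (StdForm.antidiagonal 3).over K) (hd : UnramifiedLocalConjDatum σ ϖ) (h2 : (2 : K) ≠ 0)
    (hσO : ∀ y : 𝒪[K], (σ.comp 𝒪[K].subtype) y ∈ 𝒪[K]) {y z : K} (hy : Valued.v y = 1) (hzv : Valued.v z ≤ 1) (hz : z + σ z + y * σ y = 0)
    {m N : ℕ} (hm : 1 ≤ m) (hmN : m ≤ N) (hN : N < 2 * m)
    {c um τ : ↥(unitaryGroupOfForm σ J)} (hc : ((c : GL (Fin 3) K) : Matrix (Fin 3) (Fin 3) K) = !![1, 0, 0; 0, -1, 0; 0, 0, 1])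
    (hum : ((um : GL (Fin 3) K) : Matrix (Fin 3) (Fin 3) K) = !![ϖ ^ m, y, z * (ϖ ^ m)⁻¹; 0, 1, -σ y * (ϖ ^ m)⁻¹; 0, 0, (ϖ ^ m)⁻¹])
    {A B₁ B₂ D b κ b₀ G r s w₀ y₀ : K} (hs : s = -(y * σ y)) (hκ : Valued.v κ ≤ 1) (htr : Valued.v (κ + σ κ) = 1) (hrv : Valued.v r ≤ 1)
    (hb₀ : b₀ + σ b₀ = 1) (hb₀v : Valued.v b₀ ≤ 1)
    (hB₁ : B₁ = κ * σ κ * B₂) (hAD : A - D = (σ κ - κ) * B₂) (hG : B₂ * G = (D - b - κ * B₂) * s) (hr : r * (κ + σ κ) = b₀ * G + σ b₀ * σ G)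
    (hB : Valued.v B₂ = Valued.v (ϖ ^ N)) (hc0 : z + r = κ * w₀ + y₀) (hσw₀ : σ w₀ = w₀) (hσy₀ : σ y₀ = -y₀)
    (hτ : ((τ : GL (Fin 3) K) : Matrix (Fin 3) (Fin 3) K) = !![A, 0, B₁; 0, b, 0; B₂, 0, D])
    (hτH : τ ∈ Subgroup.centralizer ({c} : Set ↥(unitaryGroupOfForm σ J)))
    (hC : Valued.v (r * (s + r)) ≤ Valued.v (ϖ ^ (2 * m - N))) (hΔ : Valued.v (G - σ G) ≤ Valued.v (ϖ ^ (2 * m - N)))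
    {q : ℕ} (hq : Nat.card (ResidueField 𝒪[K]) = q ^ 2)
    {a₀ : 𝒪[K]} (ha₀ : IsUnit (((σ.comp 𝒪[K].subtype).codRestrict 𝒪[K] hσO) a₀ - a₀))
    (hSN : flickerPH σ J c ⊓ flickerHK σ J c um ≤ flickerPH0 σ J c (ϖ ^ m))
    [Finite (↥(flickerPH σ J c) ⧸ (flickerHK σ J c um).subgroupOf (flickerPH σ J c))] {F : ℕ}
    (hfib : ∀ z ∈ Set.range (fun w : ↥(flickerPH σ J c) ⧸ (flickerHK σ J c um).subgroupOf (flickerPH σ J c) =>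
        flickerPHRho σ m ((Quotient.out w : ↥(flickerPH σ J c)) : ↥(unitaryGroupOfForm σ J))),
      Nat.card {w : ↥(flickerPH σ J c) ⧸ (flickerHK σ J c um).subgroupOf (flickerPH σ J c) //
        flickerPHRho σ m ((Quotient.out w : ↥(flickerPH σ J c)) : ↥(unitaryGroupOfForm σ J)) = z} = F) :
    Nat.card {w : ↥(flickerPH σ J c) ⧸ (flickerHK σ J c um).subgroupOf (flickerPH σ J c) //
      ((Quotient.out w : ↥(flickerPH σ J c)) : ↥(unitaryGroupOfForm σ J))⁻¹ * τ * (Quotient.out w : ↥(flickerPH σ J c)) ∈ flickerHK σ J c um} =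
      F * ((q ^ (m - (m - N / 2)) * (q ^ (m - 1) * (q + 1))) * q ^ (m - (m - N / 2))) := by
  have hN' : N ≤ 2 * m := hN.le
  have htr0 : κ + σ κ ≠ 0 := fun h => by rw [h, map_zero] at htr; exact zero_ne_one htr
  have hσr : σ r = r := map_eq_self_of_mul_trace_eq σ hd.σσ htr0 hr
  have hvs : Valued.v s = 1 := by rw [hs, Valuation.map_neg, map_mul, hd.vσ, hy, mul_one]
  have hzs : z + σ z = s := by rw [hs]; linear_combination hz
  -- `|w₀| = 1`: `(κ + σκ)w₀ = s + 2r` and `|r(s+r)| < 1`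
  have hkw : (κ + σ κ) * w₀ = s + 2 * r := by
    have h := congrArg σ hc0
    rw [map_add, map_add, map_mul, hσr, hσw₀, hσy₀] at h
    linear_combination hzs - hc0 - h
  have hρ1 : Valued.v (ϖ ^ (2 * m - N)) < 1 := by rw [hd.v_pow, ← WithZero.exp_zero, WithZero.exp_lt_exp]; omega
  have hw₀1 : Valued.v w₀ = 1 := v_eq_one_of_trace_mul_eq σ htr hvs hkw (lt_of_le_of_lt hC hρ1)
  have hy₀v : Valued.v y₀ ≤ 1 := by
    have e : y₀ = z + r - κ * w₀ := by linear_combination -hc0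
    rw [e]
    refine le_trans (Valuation.map_sub _ _ _) (max_le (le_trans (Valuation.map_add _ _ _) (max_le hzv hrv)) ?_)
    rw [map_mul, hw₀1, mul_one]; exact hκ
  have vle : ∀ {a b : ℕ}, Valued.v (ϖ ^ a) ≤ Valued.v (ϖ ^ b) ↔ b ≤ a := fun {a b} => by
    rw [hd.v_pow, hd.v_pow, WithZero.exp_le_exp]; omega
  have hB₂m : Valued.v B₂ ≤ Valued.v (ϖ ^ m) := by rw [hB, vle]; exact hmN
  obtain ⟨hDB, hAB⟩ := v_sub_le_v_B₂_of_letters σ hd.vσ hvs hκ hrv hb₀ hb₀v hAD hG hr (le_trans hΔ (hd.v_pow_le_one _))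
  refine natCard_cosets_of_iff_box_of_unram σ hJ hd h2 hσO hm (k := m - N / 2) (by omega) (by omega) hc hw₀1 hσw₀ hy₀v hσy₀ ?_ hq ha₀ hSN hfib
  -- the binder `hbd`: criterion ⟺ box
  intro p hp u x wc hpm
  obtain ⟨hvu, hvx, hσx, hvw, -⟩ := borel_coords_of_mem_flickerPH' σ hJ hd.σσ hd.vσ h2 hc hp hpm
  have hu0 : u ≠ 0 := fun h => by rw [h, map_zero] at hvu; exact zero_ne_one hvu
  have hσu0 : σ u ≠ 0 := fun h => hu0 (by rw [← hd.σσ u, h, map_zero])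
  have hw0 : wc ≠ 0 := fun h => by rw [h, map_zero] at hvw; exact zero_ne_one hvw
  have hpH : p ∈ Subgroup.centralizer ({c} : Set ↥(unitaryGroupOfForm σ J)) := ((mem_flickerPH_iff h2 hc).1 hp).1.1
  have hn : Valued.v (u * σ u) = 1 := by rw [map_mul, hd.vσ, hvu, mul_one]
  have hσn : σ (u * σ u) = u * σ u := by rw [map_mul, hd.σσ, mul_comm]
  have hws : (x + z) + σ (x + z) = s := by rw [hs]; exact (add_map_eq_neg_norm_of_rel σ hd.vσ hy hz hσx).1
  obtain ⟨hwv, hσwv, -, -, -⟩ := trace_fibre_coord σ hd hy hzv hz hvx hσx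
  rw [borel_conj_mem_flickerHK_iff_of_rel_normForm σ hJ hd hy hz m hu0 hσu0 hw0 hσx hum hpm hτ hpH hτH rfl,
    and_iff_right (show Valued.v ((u * σ u) * B₂) ≤ 1 by rw [map_mul, hn, one_mul, hB]; exact hd.v_pow_le_one N)]
  have hbox := corner_four_iff_box_of_bounded_trace σ hd (b := b) hB hN' hn hσn hws hκ htr hb₀ hb₀v hB₁ hAD hG hr hC hΔ rfl hσx hc0 hσw₀ hσy₀
  have h23 := (conditions_two_three_iff_of_v_B₂_le σ (A := A) (D := D) (b := b) hB₂m hn hwv hσwv).2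
    ⟨le_trans hAB hB₂m, le_trans hDB hB₂m⟩
  constructor
  · rintro ⟨-, -, h₄⟩; exact hbox.1 h₄
  · intro hb; exact ⟨h23.1, h23.2, hbox.2 hb⟩

/-- **FLICKER'S PROPOSITION 13, regime `m ≤ N`, TRACE FRAME — ED. 2 form (`N = 0` admitted)**: for the `j = 0` corner `τ = !![A,0,B₁;0,b,0;B₂,0,D] ∈ H` bound to the level element
`u_m^{(y,z)}` by the trace letters (`B₁ = κσκB₂`, `A − D = (σκ − κ)B₂`, `B₂G = (D − b − κB₂)s`, `r(κ+σκ) = b₀G + σb₀σG`, `b₀ + σb₀ = 1`, `s = −yσy`, `z + r = κw₀ + y₀`), `|B₂| = |ϖ^N|`,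
the regime datum `N₊ < N` (then `|D − b| = |ϖ^{N₊}|`) OR `N ≤ N₊ ∧ N ≤ M ∧ |r(s+r)| ≤ |ϖ^{M−N}| ∧ (1 ≤ N → =) ∧ |G − σG| = |ϖ^M|`, `|r| ≤ 1` in type B, and Prop. 8's numbers as the
binders `hidx0 hidx hSN [Finite] hfib`: for every `m ≤ N`, **`(#{y ∈ P_H ⧸ (P_H ∩ H^K_m) : y⁻¹ τ y ∈ H^K_m} : ℚ) = iThirteen q N N₊ M m`** — ★ `natCard_cosets_eq_iThirteen`'s conclusion VERBATIM,
the `m ≤ N` companion of LH4-p01's `natCard_cosets_jzero_eq_iThirteen_of_lt_of_rel'` (same letters, same order).  Cells: `m = 0` and `2m ≤ min(N, N₊)` ★ (C3c)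
`natCard_cosets_eq_index_of_le_of_rel`; type A `N₊ < 2m` L1 `natCard_cosets_jzero_eq_zero_of_v_lt_of_rel`; case (b) `natCard_cosets_jzero_bd_of_le_of_rel`; case (c) odd L1
`natCard_cosets_jzero_eq_zero_of_odd_of_rel`, even `conj_mem_flickerHK_iff_norm_sub_le_of_le_of_rel` + LH7-p02's `natCard_cosets_of_iff_norm_sub_le_xshape` BY NAME (centre `ξ₀ := z + r`).
[cite: Flicker1998UnitaryFL, Prop. 13 (a)(b)(c) pp. 91–93; Prop. 8 p. 84] -/
theorem natCard_cosets_jzero_eq_iThirteen_of_le_of_rel' (hJ : J = (StdForm.antidiagonal 3).over K) (hd : UnramifiedLocalConjDatum σ ϖ) (h2 : (2 : K) ≠ 0)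
    (hσO : ∀ y : 𝒪[K], (σ.comp 𝒪[K].subtype) y ∈ 𝒪[K]) {y z : K} (hy : Valued.v y = 1) (hzv : Valued.v z ≤ 1) (hz : z + σ z + y * σ y = 0)
    {m N Np M : ℕ} (hmN : m ≤ N)
    {c um τ : ↥(unitaryGroupOfForm σ J)} (hc : ((c : GL (Fin 3) K) : Matrix (Fin 3) (Fin 3) K) = !![1, 0, 0; 0, -1, 0; 0, 0, 1])
    (hum : ((um : GL (Fin 3) K) : Matrix (Fin 3) (Fin 3) K) = !![ϖ ^ m, y, z * (ϖ ^ m)⁻¹; 0, 1, -σ y * (ϖ ^ m)⁻¹; 0, 0, (ϖ ^ m)⁻¹])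
    {A B₁ B₂ D b κ b₀ G r s w₀ y₀ : K} (hs : s = -(y * σ y)) (hκ : Valued.v κ = 1) (htr : Valued.v (κ + σ κ) = 1) (hrv : N ≤ Np → Valued.v r ≤ 1)
    (hb₀ : b₀ + σ b₀ = 1) (hb₀v : Valued.v b₀ ≤ 1)
    (hB₁ : B₁ = κ * σ κ * B₂) (hAD : A - D = (σ κ - κ) * B₂) (hG : B₂ * G = (D - b - κ * B₂) * s) (hr : r * (κ + σ κ) = b₀ * G + σ b₀ * σ G)
    (hc0 : z + r = κ * w₀ + y₀) (hσw₀ : σ w₀ = w₀) (hσy₀ : σ y₀ = -y₀)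
    (hτ : ((τ : GL (Fin 3) K) : Matrix (Fin 3) (Fin 3) K) = !![A, 0, B₁; 0, b, 0; B₂, 0, D])
    (hτH : τ ∈ Subgroup.centralizer ({c} : Set ↥(unitaryGroupOfForm σ J)))
    (hB : Valued.v B₂ = Valued.v (ϖ ^ N)) (hsδ : Np < N → Valued.v (D - b) = Valued.v (ϖ ^ Np))
    (hreg : Np < N ∨ (N ≤ Np ∧ N ≤ M ∧ Valued.v (r * (s + r)) ≤ Valued.v (ϖ ^ (M - N)) ∧
      (1 ≤ N → Valued.v (r * (s + r)) = Valued.v (ϖ ^ (M - N))) ∧ Valued.v (G - σ G) = Valued.v (ϖ ^ M)))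
    {q : ℕ} (hq : Nat.card (ResidueField 𝒪[K]) = q ^ 2)
    {a₀ : 𝒪[K]} (ha₀ : IsUnit (((σ.comp 𝒪[K].subtype).codRestrict 𝒪[K] hσO) a₀ - a₀))
    (hidx0 : m = 0 → ((flickerHK σ J c um).subgroupOf (flickerPH σ J c)).index = 1)
    (hidx : 1 ≤ m → ((flickerHK σ J c um).subgroupOf (flickerPH σ J c)).index = (q ^ 2 - 1) * q ^ (4 * m - 2))
    (hSN : flickerPH σ J c ⊓ flickerHK σ J c um ≤ flickerPH0 σ J c (ϖ ^ m))
    [Finite (↥(flickerPH σ J c) ⧸ (flickerHK σ J c um).subgroupOf (flickerPH σ J c))]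
    (hfib : ∀ z ∈ Set.range (fun w : ↥(flickerPH σ J c) ⧸ (flickerHK σ J c um).subgroupOf (flickerPH σ J c) =>
        flickerPHRho σ m ((Quotient.out w : ↥(flickerPH σ J c)) : ↥(unitaryGroupOfForm σ J))),
      Nat.card {w : ↥(flickerPH σ J c) ⧸ (flickerHK σ J c um).subgroupOf (flickerPH σ J c) //
        flickerPHRho σ m ((Quotient.out w : ↥(flickerPH σ J c)) : ↥(unitaryGroupOfForm σ J)) = z} = q ^ m) :
    (Nat.card {w : ↥(flickerPH σ J c) ⧸ (flickerHK σ J c um).subgroupOf (flickerPH σ J c) //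
      ((Quotient.out w : ↥(flickerPH σ J c)) : ↥(unitaryGroupOfForm σ J))⁻¹ * τ * (Quotient.out w : ↥(flickerPH σ J c)) ∈ flickerHK σ J c um} : ℚ) =
      iThirteen q N Np M m := by
  have hq0 : q ≠ 0 := by
    rintro rfl
    have h1 : 0 < Nat.card (ResidueField 𝒪[K]) := Nat.card_pos
    rw [hq] at h1; simp at h1
  have hq1 : 1 ≤ q := Nat.one_le_iff_ne_zero.2 hq0
  have hϖ0 : ϖ ≠ 0 := hd.ϖ_ne_zero
  have hvmm : Valued.v (ϖ ^ m) * Valued.v (ϖ ^ m) = Valued.v (ϖ ^ (2 * m)) := by rw [← map_mul, ← pow_add, two_mul]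
  have vle : ∀ {a b : ℕ}, Valued.v (ϖ ^ a) ≤ Valued.v (ϖ ^ b) ↔ b ≤ a := fun {a b} => by
    rw [hd.v_pow, hd.v_pow, WithZero.exp_le_exp]; omega
  have vlt : ∀ {a b : ℕ}, Valued.v (ϖ ^ a) < Valued.v (ϖ ^ b) ↔ b < a := fun {a b} => by
    rw [hd.v_pow, hd.v_pow, WithZero.exp_lt_exp]; omega
  have htr0 : κ + σ κ ≠ 0 := fun h => by rw [h, map_zero] at htr; exact zero_ne_one htr
  have hvs : Valued.v s = 1 := by rw [hs, Valuation.map_neg, map_mul, hd.vσ, hy, mul_one]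
  -- `B₁ = B₂·p` with `|p| ≤ 1`, and `|A − D| ≤ |B₂|`
  have hB₁' : B₁ = B₂ * (κ * σ κ) := by rw [hB₁]; ring
  have hp1 : Valued.v (κ * σ κ) ≤ 1 := by rw [map_mul, hd.vσ]; exact mul_le_one' hκ.le hκ.le
  have hADle : Valued.v (A - D) ≤ Valued.v B₂ := by
    rw [hAD, map_mul]
    exact le_trans (mul_le_mul' (le_trans (Valuation.map_sub _ _ _) (max_le (by rw [hd.vσ]; exact hκ.le) hκ.le)) le_rfl) (by rw [one_mul])
  -- the two eigen-differences: type A `= |ϖ^{N₊}|`-sized, type B `≤ |B₂|`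
  have hDA : ∀ ρ : ℤᵐ⁰, Valued.v B₂ ≤ ρ → (Np < N → Valued.v (ϖ ^ Np) ≤ ρ) → Valued.v (D - b) ≤ ρ ∧ Valued.v (A - b) ≤ ρ := by
    intro ρ hBρ hNpρ
    rcases hreg with hlt | ⟨hge, -, -, -, hGv⟩
    · have hD : Valued.v (D - b) ≤ ρ := by rw [hsδ hlt]; exact hNpρ hlt
      refine ⟨hD, ?_⟩
      rw [show A - b = (A - D) + (D - b) by ring]
      exact le_trans (Valuation.map_add _ _ _) (max_le (le_trans hADle hBρ) hD)
    · obtain ⟨hD, hA⟩ := v_sub_le_v_B₂_of_letters σ hd.vσ hvs hκ.le (hrv hge) hb₀ hb₀v hAD hG hr (by rw [hGv]; exact hd.v_pow_le_one M)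
      exact ⟨le_trans hD hBρ, le_trans hA hBρ⟩
  -- regime «all»: the full index
  have hall : Valued.v B₂ ≤ Valued.v (ϖ ^ m) * Valued.v (ϖ ^ m) → (Np < N → Valued.v (ϖ ^ Np) ≤ Valued.v (ϖ ^ m) * Valued.v (ϖ ^ m)) →
      Nat.card {w : ↥(flickerPH σ J c) ⧸ (flickerHK σ J c um).subgroupOf (flickerPH σ J c) //
        ((Quotient.out w : ↥(flickerPH σ J c)) : ↥(unitaryGroupOfForm σ J))⁻¹ * τ * (Quotient.out w : ↥(flickerPH σ J c)) ∈ flickerHK σ J c um} =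
      ((flickerHK σ J c um).subgroupOf (flickerPH σ J c)).index := by
    intro hB2 hNp2
    obtain ⟨hD, hA⟩ := hDA _ hB2 hNp2
    exact natCard_cosets_eq_index_of_le_of_rel σ hJ hd h2 hy hzv hz m hc hum hB₁' hp1 hτ hτH hA hD hB2
  rcases Nat.eq_zero_or_pos m with hm0 | hm
  · -- m = 0 : everything solves, one coset
    subst hm0
    rw [hall (by rw [hB, hvmm, vle]; omega) (fun _ => by rw [hvmm, vle]; omega), hidx0 rfl, iThirteen, if_pos rfl, Nat.cast_one]
  have hm0 : m ≠ 0 := by omega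
  by_cases ha2 : 2 * m ≤ N ∧ 2 * m ≤ Np
  · -- case (a): `m ≤ min([N∕2],[N₊∕2])`
    rw [hall (by rw [hB, hvmm, vle]; exact ha2.1) (fun _ => by rw [hvmm, vle]; exact ha2.2), hidx hm, cast_index_eq hq0 hm, iThirteen, if_neg hm0,
      if_pos (le_min (le_div_two_iff.2 ha2.1) (le_div_two_iff.2 ha2.2))]
  have hnotA : ¬ m ≤ min (N / 2) (Np / 2) := fun h => ha2 ⟨le_div_two_iff.1 (le_min_iff.1 h).1, le_div_two_iff.1 (le_min_iff.1 h).2⟩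
  rcases hreg with hlt | ⟨hge, hNM, hCle, hCeq, hGv⟩
  · -- type A, `N₊ < 2m` : no solution (R-kill)
    have h2m : Np < 2 * m := by omega
    have hDb : Valued.v (D - b) = Valued.v (ϖ ^ Np) := hsδ hlt
    rw [natCard_cosets_jzero_eq_zero_of_v_lt_of_rel σ hJ hd h2 hy hzv hz m hc hum hB₁' hp1 hτ hτH
        (lt_of_le_of_lt hADle (by rw [hB, hDb, vlt]; exact hlt)) (by rw [hB, hDb, vlt]; exact hlt) (by rw [hvmm, hDb, vlt]; omega),
      Nat.cast_zero, iThirteen, if_neg hm0, if_neg hnotA, if_neg (fun h => by omega), if_neg (fun h => by omega),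
      if_neg (fun h => by omega), if_neg (fun h => by omega)]
  -- type B: cases (b), (c) and the parity zero (`m ≤ N` throughout)
  have hN2 : N < 2 * m := by
    by_contra h; exact ha2 ⟨by omega, by omega⟩
  have hrv' : Valued.v r ≤ 1 := hrv hge
  by_cases hbM : 2 * m ≤ M
  · -- case (b): `N < 2m ≤ M`
    have hCv : Valued.v (r * (s + r)) ≤ Valued.v (ϖ ^ (2 * m - N)) := le_trans hCle (by rw [vle]; omega)
    have hg2 : Valued.v (G - σ G) ≤ Valued.v (ϖ ^ (2 * m - N)) := by rw [hGv, vle]; omega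
    have hcount := natCard_cosets_jzero_bd_of_le_of_rel σ hJ hd h2 hσO hy hzv hz hm hmN hN2 hc hum hs hκ.le htr hrv' hb₀ hb₀v hB₁ hAD hG hr hB
      hc0 hσw₀ hσy₀ hτ hτH hCv hg2 hq ha₀ hSN hfib
    rw [hcount, iThirteen, if_neg hm0, if_neg hnotA, if_pos ⟨hge, by omega, le_min hmN (le_div_two_iff.2 hbM)⟩]
    obtain ⟨m', rfl⟩ : ∃ m', m = m' + 1 := ⟨m - 1, by omega⟩
    rw [show m' + 1 - (m' + 1 - N / 2) = N / 2 by omega, show m' + 1 - 1 = m' by omega, cast_count_b_pack hq0 m' (N / 2)]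
  · -- `M < 2m`, `m ≤ N` (so `2m ≤ M + N`: no far row in this half)
    have hMm : M < 2 * m := by omega
    have hCv : Valued.v (r * (s + r)) = Valued.v (ϖ ^ (M - N)) := hCeq (by omega)
    have hnear : Valued.v (ϖ ^ (2 * m - N)) < Valued.v (r * (s + r)) := by rw [hCv, vlt]; omega
    have hg2 : Valued.v (G - σ G) ≤ Valued.v (ϖ ^ (2 * m - N)) := by rw [hGv, vle]; omega
    by_cases hpar : (M - N) % 2 = 0
    · -- case (c): `M − N = 2ℓ`, `ℓ ≥ 0` — the norm-residue count, BY NAME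
      obtain ⟨ℓ, hℓ⟩ : ∃ ℓ, M - N = 2 * ℓ := ⟨(M - N) / 2, by omega⟩
      have hj : 2 * ℓ < 2 * m - N := by omega
      have hjm : 2 * m - N ≤ m := by omega
      -- `r(s+r) = ϖ^{2ℓ}·γ` with `γ` a `σ`-fixed unit
      obtain ⟨γ, hγdef⟩ : ∃ γ : K, γ = r * (s + r) / ϖ ^ (2 * ℓ) := ⟨_, rfl⟩
      have hσr : σ r = r := map_eq_self_of_mul_trace_eq σ hd.σσ htr0 hr
      have hσs : σ s = s := by rw [hs, map_neg, map_mul, hd.σσ, mul_comm]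
      have hγ : Valued.v γ = 1 := by
        rw [hγdef, map_div₀, hCv, hℓ, div_self ((Valuation.ne_zero_iff _).2 (pow_ne_zero _ hϖ0))]
      have hσγ : σ γ = γ := by rw [hγdef, map_div₀, map_mul, map_add, map_pow, hσr, hσs, hd.σϖ]
      have hec : r * (s + r) = ϖ ^ (2 * ℓ) * γ := by rw [hγdef, ← mul_div_assoc, mul_div_cancel_left₀ _ (pow_ne_zero _ hϖ0)]
      -- the centre `ξ₀ := z + r` (`ξ₀ + σξ₀ = r + r + s`) of the `X`-shape
      have hξv : Valued.v (z + r) ≤ 1 := le_trans (Valuation.map_add _ _ _) (max_le hzv hrv')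
      have hξ : (z + r) + σ (z + r) = r + r + s := by rw [map_add, hσr, hs]; linear_combination hz
      have hcount := natCard_cosets_of_iff_norm_sub_le_xshape σ hJ hd h2 hσO hm hj hjm hc hκ htr hrv' hσr hvs hξv hξ hγ hσγ hec
        (fun p hp u x w hpm => by
          rw [conj_mem_flickerHK_iff_norm_sub_le_of_le_of_rel σ hJ hd h2 hy hzv hz hmN hN2.le hc hum hs hκ.le htr0 hrv' hb₀ hb₀v hB₁ hAD hG hr hB hg2
            hτ hτH hp hpm, hec, show κ * (u * σ u)⁻¹ + (x + z) + r = κ * (u * σ u)⁻¹ + x + (z + r) by ring])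
        hq ha₀ hSN hfib
      rw [hcount, iThirteen, if_neg hm0, if_neg hnotA,
        if_neg (fun h => by have := (le_min_iff.1 h.2.2).2; rw [le_div_two_iff] at this; omega),
        if_pos ⟨hge, by rw [Nat.add_one_le_iff, Nat.div_lt_iff_lt_mul (by norm_num)]; omega, hmN, hpar⟩]
      obtain ⟨r', hr'⟩ : ∃ r', m = ℓ + 1 + r' := ⟨m - ℓ - 1, by omega⟩
      obtain ⟨s', hs'⟩ : ∃ s', N = m + s' := ⟨N - m, by omega⟩
      rw [show m - ℓ - (2 * m - N - 2 * ℓ) = s' + ℓ by omega, show m - ℓ - 1 = r' by omega, show m - 1 = ℓ + r' by omega]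
      subst hs'
      subst hr'
      exact cast_count_c_pack hq0 ℓ r' s'
    · -- `M − N` odd : no solution (parity)
      have hodd : ¬ ∃ e : ℤ, Valued.v (r * (s + r)) = WithZero.exp (2 * e) := by
        rintro ⟨e, he⟩
        rw [hCv, hd.v_pow, WithZero.exp_inj] at he
        omega
      rw [natCard_cosets_jzero_eq_zero_of_odd_of_rel σ hJ hd h2 hy hz hN2.le hc hum hs htr0 hb₀ hb₀v hB₁ hAD hG hr hB hτ hτH hg2 hnear hodd,
        Nat.cast_zero, iThirteen, if_neg hm0, if_neg hnotA,
        if_neg (fun h => by have := (le_min_iff.1 h.2.2).2; rw [le_div_two_iff] at this; omega),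
        if_neg (fun h => hpar h.2.2.2), if_neg (fun h => by omega), if_neg (fun h => hpar h.2.2.2)]

/-- **FLICKER'S PROPOSITION 13, regime `m ≤ N`, TRACE FRAME** — the same with the type-B datum `|r(s+r)| = |ϖ^{M−N}|` (LH4-p01's un-primed `hreg`, ★'s `hc₁`); corollary of the
ED. 2 form.  The `m ≤ N` companion of `natCard_cosets_jzero_eq_iThirteen_of_lt_of_rel`. [cite: Flicker1998UnitaryFL, Prop. 13 (a)(b)(c) pp. 91–93; Prop. 8 p. 84] -/
theorem natCard_cosets_jzero_eq_iThirteen_of_le_of_rel (hJ : J = (StdForm.antidiagonal 3).over K) (hd : UnramifiedLocalConjDatum σ ϖ) (h2 : (2 : K) ≠ 0)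
    (hσO : ∀ y : 𝒪[K], (σ.comp 𝒪[K].subtype) y ∈ 𝒪[K]) {y z : K} (hy : Valued.v y = 1) (hzv : Valued.v z ≤ 1) (hz : z + σ z + y * σ y = 0)
    {m N Np M : ℕ} (hmN : m ≤ N)
    {c um τ : ↥(unitaryGroupOfForm σ J)} (hc : ((c : GL (Fin 3) K) : Matrix (Fin 3) (Fin 3) K) = !![1, 0, 0; 0, -1, 0; 0, 0, 1])
    (hum : ((um : GL (Fin 3) K) : Matrix (Fin 3) (Fin 3) K) = !![ϖ ^ m, y, z * (ϖ ^ m)⁻¹; 0, 1, -σ y * (ϖ ^ m)⁻¹; 0, 0, (ϖ ^ m)⁻¹])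
    {A B₁ B₂ D b κ b₀ G r s w₀ y₀ : K} (hs : s = -(y * σ y)) (hκ : Valued.v κ = 1) (htr : Valued.v (κ + σ κ) = 1) (hrv : N ≤ Np → Valued.v r ≤ 1)
    (hb₀ : b₀ + σ b₀ = 1) (hb₀v : Valued.v b₀ ≤ 1)
    (hB₁ : B₁ = κ * σ κ * B₂) (hAD : A - D = (σ κ - κ) * B₂) (hG : B₂ * G = (D - b - κ * B₂) * s) (hr : r * (κ + σ κ) = b₀ * G + σ b₀ * σ G)
    (hc0 : z + r = κ * w₀ + y₀) (hσw₀ : σ w₀ = w₀) (hσy₀ : σ y₀ = -y₀)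
    (hτ : ((τ : GL (Fin 3) K) : Matrix (Fin 3) (Fin 3) K) = !![A, 0, B₁; 0, b, 0; B₂, 0, D])
    (hτH : τ ∈ Subgroup.centralizer ({c} : Set ↥(unitaryGroupOfForm σ J)))
    (hB : Valued.v B₂ = Valued.v (ϖ ^ N)) (hsδ : Np < N → Valued.v (D - b) = Valued.v (ϖ ^ Np))
    (hreg : Np < N ∨ (N ≤ Np ∧ N ≤ M ∧ Valued.v (r * (s + r)) = Valued.v (ϖ ^ (M - N)) ∧ Valued.v (G - σ G) = Valued.v (ϖ ^ M)))
    {q : ℕ} (hq : Nat.card (ResidueField 𝒪[K]) = q ^ 2)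
    {a₀ : 𝒪[K]} (ha₀ : IsUnit (((σ.comp 𝒪[K].subtype).codRestrict 𝒪[K] hσO) a₀ - a₀))
    (hidx0 : m = 0 → ((flickerHK σ J c um).subgroupOf (flickerPH σ J c)).index = 1)
    (hidx : 1 ≤ m → ((flickerHK σ J c um).subgroupOf (flickerPH σ J c)).index = (q ^ 2 - 1) * q ^ (4 * m - 2))
    (hSN : flickerPH σ J c ⊓ flickerHK σ J c um ≤ flickerPH0 σ J c (ϖ ^ m))
    [Finite (↥(flickerPH σ J c) ⧸ (flickerHK σ J c um).subgroupOf (flickerPH σ J c))]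
    (hfib : ∀ z ∈ Set.range (fun w : ↥(flickerPH σ J c) ⧸ (flickerHK σ J c um).subgroupOf (flickerPH σ J c) =>
        flickerPHRho σ m ((Quotient.out w : ↥(flickerPH σ J c)) : ↥(unitaryGroupOfForm σ J))),
      Nat.card {w : ↥(flickerPH σ J c) ⧸ (flickerHK σ J c um).subgroupOf (flickerPH σ J c) //
        flickerPHRho σ m ((Quotient.out w : ↥(flickerPH σ J c)) : ↥(unitaryGroupOfForm σ J)) = z} = q ^ m) :
    (Nat.card {w : ↥(flickerPH σ J c) ⧸ (flickerHK σ J c um).subgroupOf (flickerPH σ J c) //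
      ((Quotient.out w : ↥(flickerPH σ J c)) : ↥(unitaryGroupOfForm σ J))⁻¹ * τ * (Quotient.out w : ↥(flickerPH σ J c)) ∈ flickerHK σ J c um} : ℚ) =
      iThirteen q N Np M m :=
  natCard_cosets_jzero_eq_iThirteen_of_le_of_rel' σ hJ hd h2 hσO hy hzv hz hmN hc hum hs hκ htr hrv hb₀ hb₀v hB₁ hAD hG hr hc0 hσw₀ hσy₀ hτ hτH hB hsδ
    (hreg.imp_right fun h => ⟨h.1, h.2.1, h.2.2.1.le, fun _ => h.2.2.1, h.2.2.2⟩) hq ha₀ hidx0 hidx hSN hfib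

end Count

end UnitaryGroup

end Literature.NumberTheory.Automorphic
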